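import Mathlib
import Summits.ValiantsHypothesis.ValiantsHypothesis.Theorems.GrenetZeonTwoDimCoefficientsLinearForm
import Summits.ValiantsHypothesis.ValiantsHypothesis.Theorems.GrenetZeonTwoDimCoefficientsPerThreeDimTwo

/-!
# Crux `GrenetZeon.TwoDimCoefficients` (stmt-ValiantsHypothesis-8062): the crux IS its last open stub

The line `dim2_cases` has four of five stubs landed; the open one is `stub_dualUnipotent :
DualUnipotentBound` (`per_n = α det A + β tr(adj A·B)`, `det A ≡ c ≠ 0` ⟹ `n² ≤ C·m`), and the tree
has `twoDimCoefficients_of_dualUnipotentBound : HessianRankCodimTwo → DualUnipotentBound →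
TwoDimCoefficients` (`…LinearForm.lean`).  This file records the CONVERSE, which is unconditional and
one line: a unipotent dual representation of size `m` is an `(m, ≤ 2)`-representation over the dual
numbers (`hasDim2Repr_of_dualRepr`, `…PerThreeDimTwo.lean`), so `TwoDimCoefficients` implies
`DualUnipotentBound` (`dualUnipotentBound_of_twoDimCoefficients`).  Hence

* `twoDimCoefficients_iff_dualUnipotentBound (hH : HessianRankCodimTwo) :
  TwoDimCoefficients ↔ DualUnipotentBound` —

modulo the dependency crux `HessianRankCodimTwo` (stmt-8061, whose all-`n` proof is being assembled in
`…GrenetZeonHessianRankCodimTwoBorder*.lean`), the crux `TwoDimCoefficients` AS TYPED is EQUIVALENT to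
its isolated open sub-case.  Consequence for the planners: no re-lining of 8062 can avoid
`DualUnipotentBound` (open-problem grade, `CALIBRATION-stub_dualUnipotent.md`, `PROFILE-BARRIER-…md`);
the disjunctive re-typing (`hasDim2Repr_sq_le_or_unipotent_of_hessianRankCodimTwo`) is the part that
closes from 8061 alone.  VP ≠ VNP is not moved by anything here (constant-factor statements inside the
Mignon–Ressayre regime).
-/

-- single-conjunct layout `Summits/ValiantsHypothesis/ValiantsHypothesis`: the duplicated namespace
-- component is mandated by the tree.
set_option linter.dupNamespace false

noncomputable section

namespace Summit.ValiantsHypothesis.ValiantsHypothesis.Cruxes.TwoDimCoefficients.DimTwoCases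

open Literature.Computability.AlgebraicComplexity
open Summit.ValiantsHypothesis.ValiantsHypothesis.Theses.GrenetZeon

/-- **The crux implies its open stub, unconditionally:** `TwoDimCoefficients → DualUnipotentBound`
(a unipotent dual representation is a dual representation is an `(m, ≤ 2)`-representation).
[folklore] -/
theorem dualUnipotentBound_of_twoDimCoefficients (h : TwoDimCoefficients) : DualUnipotentBound := by
  obtain ⟨C, n₀, hC⟩ := h
  exact ⟨C, n₀, fun n hn m hrep =>
    hC n hn m (hasDim2Repr_of_dualRepr (dualRepr_of_dualUnipotentRepr hrep))⟩

/-- **Modulo 8061 the crux IS its last open stub:** given `HessianRankCodimTwo`,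
`TwoDimCoefficients ↔ DualUnipotentBound`. [folklore] -/
theorem twoDimCoefficients_iff_dualUnipotentBound (hH : HessianRankCodimTwo) :
    TwoDimCoefficients ↔ DualUnipotentBound :=
  ⟨dualUnipotentBound_of_twoDimCoefficients, twoDimCoefficients_of_dualUnipotentBound hH⟩

/-- **Equivalently, in the disjunctive packaging:** given the disjunctive form of the crux (which
follows from `HessianRankCodimTwo` alone, `hasDim2Repr_sq_le_or_unipotent_of_hessianRankCodimTwo`),
`TwoDimCoefficients ↔ DualUnipotentBound`. [folklore] -/
theorem twoDimCoefficients_iff_dualUnipotentBound_of_disjunctive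
    (hdis : ∃ C n₀ : ℕ, ∀ n ≥ n₀, ∀ m : ℕ, HasDim2Repr n m → n ^ 2 ≤ C * m ∨ DualUnipotentRepr n m) :
    TwoDimCoefficients ↔ DualUnipotentBound :=
  ⟨dualUnipotentBound_of_twoDimCoefficients, twoDimCoefficients_of_disjunctive hdis⟩

end Summit.ValiantsHypothesis.ValiantsHypothesis.Cruxes.TwoDimCoefficients.DimTwoCases

end
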